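import Summits.ABC.IUTFork.LDHGenuinePerImageContentfulAll
import Summits.ABC.IUTFork.LDHGenuineTowerArithPinnedP
import Literature.IUT.LogVolume.GenuineRamificationBoundsPinned
import HarnessLib

/-!
# The fork at [IUTchIII] Corollary 3.12, L-DH level, READING (P): the NECESSITY half at EVERY datum in PRINT'S currency `B_III`
# — the (P)-line crux at `(P, l)` forces [IUTchIV] Thm. 1.10's display POINTWISE (abc-iut cell, crux ThetaPartII = stmt-ABC-19678)

Record-only PROOF file (D-0012) of the abc-iut cell (WAVE-3 discharge seat abc-iut-c312-d1, gen 7; row «P-CRUX-SUFFICIENCY», part F);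
TAKES NO SIDE on [IUTchIII] Cor. 3.12 or on the (U)/(P) readings. Companion of part E (`LDHGenuinePerImageContentfulAll`, p448016: all-data
necessity with the π-free additive term `(5/3)·(3 + log E₀)·(E₀ + 3)`, `E₀ = 184320·[F_tpd:ℚ]·l⁴`). HERE the same in PRINT's currency: this
lineage's gen-5 closer of the (ii′-P) stub (`PointDict.hullEstimatePerImageOf_BIII_pinned`, p424617/p425589 — the per-image Step (v)
estimate with the constant `B_III(P,l) = (l+1)/4·{(1 + 12 d_mod/l)·(log-diff + log 𝔣^{∤2l}) + 2 log l + 52 + (20/3)·log(d*_mod·l)·π(d*_mod·l)}`,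
`d*_mod = 2^12·3^3·5·d_mod`, [IUTchIV] Thm. 1.10 Steps (ii)–(viii)) with its (R4) hypothesis DISCHARGED for every datum by abc-iut-S3/S1's
`Cor22.ThetaVolumeDatumAt.R4_towerFact` (print's (R4), Step (iii) p. 26, no residual hypothesis), composed with the squeeze `gap_le_perImage`:

* **`PointDict.gap_le_BIII_of_cor312PerImageAtDatum`** — `P ∈ UP`, `l ≥ 7`, ANY datum `T`:
  `Cor312PerImageAtDatum P l ⟹ ((l+1)/24 − 1/(2l))·log q^{∤2l}(λ) ≤ B_III(P,l) + ((l+5)/4)·log π` — the display of Thm. 1.10 POINTWISE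
  (abc-iut-S-d2's `display_of_cor312PerImage_via_verbatim` needs the stub at ALL points; this needs it at `(P, l)` only);
* **`PointDict.szpiro_of_cor312PerImageAtDatum_six_BIII`** — Szpiro form:
  `(1/6 − 2/(l(l+1)))·log q^{∤2l} ≤ (1 + 12 d_mod/l)·(log-diff + log-cond) + 2 log l + 52 + (20/3)·log(d*_mod·l)·π(d*_mod·l) + 2 log π`
  (constant `↓ 6`; additive term `≈ 20·40·d*_mod·l/4` by Chebyshev, print's `20·(d*_mod·l + η)` shape — SMALLER than part E's for every `l`);
* **`Cor22.cor312PerImageAtDatum_sandwich_dmod_one_BIII`** — the sandwich at `d_mod = 1` with part B's sufficiency (p446147):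
  Szpiro(`6l(l+1)/((l+4)(l−3))`) ⟹ (P)-crux ⟹ [ANY datum] Szpiro(`(1+12/l)/(1/6 − 2/(l(l+1)))`) + `2 log l + 52 + (20/3)·log(552960·l)·π(552960·l) + 2 log π`.

Nothing here asserts `Cor312PerImageAtDatum` for any point or the existence of data; no side taken. [cite: Mochizuki2012, IUTchIII Cor.
3.12 p. 173–174; IUTchIV Thm. 1.10 p. 22–23, proof Steps (ii)–(x) p. 24–32] [claim: Mochizuki2012, status: disputed] for every IUT quotation.
PROOF-ONLY: no definitions, no new `Prop`; typed ≠ proved.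
-/

noncomputable section

namespace Summit.ABC.IUTFork

open Literature.IUT.HodgeTheaters Literature.IUT.LogVolume NumberField IsDedekindDomain
open Literature.NumberTheory.DiophantineGeometry.GenEll
open scoped Nat.Prime

namespace PointDict

variable {P : NFPoint} {l : ℕ}

/-- **[IUTchIV] Thm. 1.10's display POINTWISE from the (P)-line crux at `(P, l)`**: for `P ∈ UP`, `l ≥ 7` and ANY genuine datum `T`,
`Cor312PerImageAtDatum P l ⟹ κ_l·log q^{∤2l}(λ) ≤ B_III(P,l) + ((l+5)/4)·log π` (this lineage's `hullEstimatePerImageOf_BIII_pinned` with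
(R4) discharged by `T.R4_towerFact`, and the squeeze `gap_le_perImage`). [cite: Mochizuki2012, IUTchIV Thm. 1.10 p. 22–23, proof Steps
(v)–(x) p. 27–32] [claim: Mochizuki2012, status: disputed] -/
theorem gap_le_BIII_of_cor312PerImageAtDatum (hP : P ∈ UP) (h7 : 7 ≤ l) (h : Cor22.Cor312PerImageAtDatum P l)
    (T : Cor22.ThetaVolumeDatumAt P l) :
    (((l : ℝ) + 1) / 24 - 1 / (2 * l)) * Cor22.logQAvoid P {2, l} ≤
      ((l : ℝ) + 1) / 4 * ((1 + 12 * (Cor22.dmod P : ℝ) / l) * (P.logDiff + Cor22.logCondAvoid P {2, l})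
        + 2 * Real.log l + 52
        + 20 / 3 * Real.log (((2 ^ 12 * 3 ^ 3 * 5 * Cor22.dmod P : ℕ) : ℝ) * (l : ℝ))
          * (Nat.primeCounting (2 ^ 12 * 3 ^ 3 * 5 * Cor22.dmod P * l) : ℝ))
      + ThetaVolumeInput.archLogTheta l := by
  rw [← gap_eq T hP.1]
  exact T.gap_le_perImage (h T) (hullEstimatePerImageOf_BIII_pinned T hP h7 (T.R4_towerFact hP))

/-- **ALL DATA, SZPIRO FORM IN PRINT'S CURRENCY**: `Cor312PerImageAtDatum P l ⟹ (1/6 − 2/(l(l+1)))·log q^{∤2l}(λ) ≤ (1 + 12 d_mod/l)·(log-diff +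
log-cond) + 2 log l + 52 + (20/3)·log(d*_mod·l)·π(d*_mod·l) + 2 log π` at ANY datum — constant `↓ 6`, additive term of print's `20·(d*_mod·l + η)`
shape ([IUTchIV] Thm. 1.10, display p. 22–23). [cite: Mochizuki2012, IUTchIV Thm. 1.10 p. 22–23] [claim: Mochizuki2012, status: disputed] -/
theorem szpiro_of_cor312PerImageAtDatum_six_BIII (hP : P ∈ UP) (h7 : 7 ≤ l) (h : Cor22.Cor312PerImageAtDatum P l)
    (T : Cor22.ThetaVolumeDatumAt P l) :
    (1 / 6 - 2 / ((l : ℝ) * ((l : ℝ) + 1))) * Cor22.logQAvoid P {2, l} ≤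
      (1 + 12 * (Cor22.dmod P : ℝ) / l) * (P.logDiff + Cor22.logCondAvoid P {2, l})
        + 2 * Real.log l + 52
        + 20 / 3 * Real.log (((2 ^ 12 * 3 ^ 3 * 5 * Cor22.dmod P : ℕ) : ℝ) * (l : ℝ))
          * (Nat.primeCounting (2 ^ 12 * 3 ^ 3 * 5 * Cor22.dmod P * l) : ℝ)
        + 2 * Real.log Real.pi := by
  have hmain := gap_le_BIII_of_cor312PerImageAtDatum hP h7 h T
  have hl7 : (7 : ℝ) ≤ l := by exact_mod_cast h7
  have hl0 : (0 : ℝ) < l := by linarith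
  have hl1 : (0 : ℝ) < (l : ℝ) + 1 := by linarith
  have harch : ThetaVolumeInput.archLogTheta l = ((l : ℝ) + 5) / 4 * Real.log Real.pi := rfl
  rw [harch] at hmain
  set M : ℝ := (1 + 12 * (Cor22.dmod P : ℝ) / l) * (P.logDiff + Cor22.logCondAvoid P {2, l})
        + 2 * Real.log l + 52
        + 20 / 3 * Real.log (((2 ^ 12 * 3 ^ 3 * 5 * Cor22.dmod P : ℕ) : ℝ) * (l : ℝ))
          * (Nat.primeCounting (2 ^ 12 * 3 ^ 3 * 5 * Cor22.dmod P * l) : ℝ) with hM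
  have hpi0 : 0 ≤ Real.log Real.pi := Real.log_nonneg (by linarith [Real.pi_gt_three])
  have key : (4 / ((l : ℝ) + 1)) * ((((l : ℝ) + 1) / 24 - 1 / (2 * l)) * Cor22.logQAvoid P {2, l}) ≤
      (4 / ((l : ℝ) + 1)) * (((l : ℝ) + 1) / 4 * M + ((l : ℝ) + 5) / 4 * Real.log Real.pi) :=
    mul_le_mul_of_nonneg_left hmain (by positivity)
  have e1 : (4 / ((l : ℝ) + 1)) * ((((l : ℝ) + 1) / 24 - 1 / (2 * l)) * Cor22.logQAvoid P {2, l}) =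
      (1 / 6 - 2 / ((l : ℝ) * ((l : ℝ) + 1))) * Cor22.logQAvoid P {2, l} := by
    field_simp
    ring
  have e2 : (4 / ((l : ℝ) + 1)) * (((l : ℝ) + 1) / 4 * M + ((l : ℝ) + 5) / 4 * Real.log Real.pi) =
      M + ((l : ℝ) + 5) / ((l : ℝ) + 1) * Real.log Real.pi := by
    field_simp
  rw [e1, e2] at key
  have hpi : ((l : ℝ) + 5) / ((l : ℝ) + 1) * Real.log Real.pi ≤ 2 * Real.log Real.pi := by
    have : ((l : ℝ) + 5) / ((l : ℝ) + 1) ≤ 2 := by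
      rw [div_le_iff₀ hl1]; linarith
    exact mul_le_mul_of_nonneg_right this hpi0
  rw [hM] at key
  linarith

end PointDict

end Summit.ABC.IUTFork

namespace Literature.IUT.LogVolume.Cor22

open Literature.NumberTheory.DiophantineGeometry.GenEll Summit.ABC.IUTFork Literature.IUT.HodgeTheaters

variable {P : NFPoint} {l : ℕ}

/-- **THE SANDWICH AT `d_mod = 1` IN PRINT'S CURRENCY**: for `λ ∈ U_X` minimally presented with `j(λ) ∈ ℚ` and a prime `l ≥ 7`:
(⇐) `log q^{∤2l} ≤ (6l(l+1)/((l+4)(l−3)))·(log-diff + (1 − 1/l)·log-cond) + (6l(l+5)/((l+4)(l−3)))·log π ⟹ Cor312PerImageAtDatum P l` (p446147);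
(⇒) `Cor312PerImageAtDatum P l ⟹` at ANY datum: `(1/6 − 2/(l(l+1)))·log q^{∤2l} ≤ (1 + 12/l)·(log-diff + log-cond) + 2 log l + 52 +
(20/3)·log(552960·l)·π(552960·l) + 2 log π`. Both Szpiro constants tend to `6`. No side taken on which holds at any point.
[cite: Mochizuki2012, IUTchIII Cor. 3.12 p. 173–174; IUTchIV Thm. 1.10 p. 22–23] [claim: Mochizuki2012, status: disputed] -/
theorem cor312PerImageAtDatum_sandwich_dmod_one_BIII (hP : P ∈ UP) (h7 : 7 ≤ l) (hd : dmod P = 1) :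
    (logQAvoid P {2, l} ≤
        6 * l * ((l : ℝ) + 1) / (((l : ℝ) + 4) * ((l : ℝ) - 3))
            * (P.logDiff + (1 - 1 / (l : ℝ)) * logCondAvoid P {2, l})
          + 6 * l * ((l : ℝ) + 5) / (((l : ℝ) + 4) * ((l : ℝ) - 3)) * Real.log Real.pi →
      Cor312PerImageAtDatum P l) ∧
    (Cor312PerImageAtDatum P l → ∀ T : ThetaVolumeDatumAt P l,
      (1 / 6 - 2 / ((l : ℝ) * ((l : ℝ) + 1))) * logQAvoid P {2, l} ≤
        (1 + 12 * (1 : ℝ) / l) * (P.logDiff + logCondAvoid P {2, l}) + 2 * Real.log l + 52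
          + 20 / 3 * Real.log (((2 ^ 12 * 3 ^ 3 * 5 * 1 : ℕ) : ℝ) * (l : ℝ))
            * (Nat.primeCounting (2 ^ 12 * 3 ^ 3 * 5 * 1 * l) : ℝ)
          + 2 * Real.log Real.pi) := by
  refine ⟨fun h => cor312PerImageAtDatum_of_szpiroSix hP.1 (by omega) hd h, fun h T => ?_⟩
  have hmain := PointDict.szpiro_of_cor312PerImageAtDatum_six_BIII hP h7 h T
  rw [hd] at hmain
  simpa using hmain

end Literature.IUT.LogVolume.Cor22

end
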